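import Summits.QuantumFields.YangMills.Theorems.TwistedTraceScaling.Negative.SliceWindingCopies
import Summits.QuantumFields.YangMills.Theorems.LuscherReductionTwistedTraceScalingRecordBricks
import Summits.QuantumFields.YangMills.Theorems.LuscherReductionTwistedTraceScalingGaugeAverageBased
import Summits.QuantumFields.YangMills.Theorems.LuscherReductionTwistedTraceScalingBTSchedule
import HarnessLib

/-!
# R64 — the BASED window set `{h : gaugeCoordSq(U^{basedExt h}) ≤ c}` of a support point is NOT contained in the tube `nearOne ρ`, on a set of POSITIVE based-Haar mass:
# the (S6′)/(W1-2) «window lemma» of the (B-ST) pen can only hold in MASS form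
# (crux disprover of `TwistedTraceScaling`, stmt-QuantumFields-20203, cycle 52; `--supports` the crux; negative lane, def-free)

Lane A's (B-ST) assembly recipe (pub `ym-luscher-20007-p1/HANDOFF-g21.md`, UPDATE 19:05Z, step (S6′), for the gauge-far tail of ✓`…BOStiffAssembly.hST_of_pieces`)
proposed to feed the POINTWISE window ratio `κ_A(U) = P₀(𝟙_Aχ)(U)/P₀χ(U)` of ✓`…BOStiffTailFP.l2_basedAvg_indicator_le` through a WINDOW LEMMA stated as a set inclusion:
«for `recordChi U ≠ 0` the based orbit's Gaussian bulk `{h : gaugeCoordSq(U^{basedExt h}) ≤ ½(β^{-1}btLog β)²}` lies inside `nearOne(MKβ^{-s}) ∩ {orbitDist < Kβ^{-s}}`».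
This file shows that the INCLUSION form is false — at the simplest support point, the vacuum `1̄` — and that it fails on a set of positive based-Haar mass, so that no
almost-everywhere variant survives either.  (The landed instance ✓`…BOStiffTailFarRecord.basedAvg_indicator_far_le_of_sandwich` does NOT use the inclusion: it bounds `κ_A` by the
two-width sandwich `𝟙_Aχ_{δg} ≤ e^{−τ²/(2δg²)}χ_{√2δg}` plus (P) `…FPWeightCore.fpWeight_core_constant` on the whole fat tube, an AVERAGE statement, and is unaffected — this file is
the guard explaining why only average / mass forms of the window statement can hold, for the later pointwise steps of the pen: the based off-core kernel tail (S2-tail) and any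
defect-function window.)  What a pointwise argument can use is the MASS form (a lower bound for the based-Haar mass of `{h : U^h ∈ fat tube, gaugeCoordSq(U^h) ≤ ½w²}` uniform over
`orbitDist U < Kβ^{-s}`), which the exceptional set below does not obstruct because the record weight VANISHES on it.  The mechanism is R29 (✓ `Negative/SliceWindingCopies`): the
linearised slice `gaugeCoordSq = 0` meets the vacuum orbit again at the winding pure-gauge copies, far from `1̄`, and these copies are reached by BASED gauge transformations.
* §1 `basedExt_winding`, ★ `vacuum_basedCopy`: the winding gauge function `x ↦ diagSU2((2π/L)x₀)` takes the value `1` at the origin, so it IS a based transformation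
  `basedExt h_w`, and `1̄^{basedExt h_w} = constLift(diagSU2(−2π/L), 1, 1)` (R29 `winding_eq_constLift`); ★ `gaugeCoordSq_vacuum_basedCopy = 0`,
  ★ `vacuum_basedCopy_not_mem_nearOne` (`ρ ≤ 2√(1 − cos(2π/L))`).
* §2 `recordChi_one = 1`: the vacuum is a support point of the record weight for all positive radii (`gaugeCoordSq_one = 0`, `orbitDist 1̄ = 0`).
* §3 ★★ `based_window_not_subset`: `{h | gaugeCoordSq(1̄^{basedExt h}) ≤ c} ⊄ {h | 1̄^{basedExt h} ∈ nearOne ρ}` for every `c ≥ 0`, `ρ ≤ 2√(1 − cos(2π/L))`;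
  ★★ `based_window_containment_eventually_fails`: for the record radii (`s, K, M > 0`, `L ≥ 2`), eventually in `β`, `recordChi β 1̄ = 1` and the based orbit of `1̄` has a
  point in the bulk `{gaugeCoordSq ≤ ½(β^{-1}btLog β)²}` outside `nearOne(MKβ^{-s})` with `recordChi = 0` there.
* §4 ★ `gaugeCoordSq_le_defect`: `gaugeCoordSq U ≤ 2Σ_k(|sites| − ‖M_k(U)‖)` wherever the direction sums `M_k` are nonzero — a CONTINUOUS majorant vanishing at constant
  configurations (`…PolarMean.sum_scalarPart_mul_polarMean_inv`; no continuity of the polar mean is needed); `isOpen_island` / `winding_mem_island` /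
  `basedMeasure_island_pos`: the neighbourhood `{h : ‖(1̄^h)_{(0,0)} − 1‖_F > ρ, ‖M_k(1̄^h)‖ > |sites| − c ∀k}` of `h_w` is open, hence of positive product-Haar mass;
  ★★ `basedMeasure_window_diff_nearOne_pos`: `basedMeasure {h | gaugeCoordSq(1̄^h) ≤ c ∧ 1̄^h ∉ nearOne ρ} > 0` (`c > 0`, `ρ < 2√(1 − cos(2π/L))`);
  ★★ `basedMeasure_bulk_off_support_eventually_pos`: eventually in `β`, a positive-mass set of based `h` carries `1̄` (weight `1`) into the bulk and OUT of `supp recordChi`.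
USE (for lane A's pointwise steps): lower-bound `P₀χ(U)` by the honestly CENTRED bulk ball only (`orbitDist U < δ` ⇒ a representative with `Σ_e‖U_e − 1‖_F < δ`, whose centring stays in
`nearOne(≈2δ) ⊂ nearOne(Mδ)`), never by the whole level set of `gaugeCoordSq`; the islands cost nothing there since `χ = 0` on them, and `κ_A ≤ e^{−btLog²/2}·(1/m_bulk)` with
`m_bulk ≳ (β^{-1}btLog β/C(L))^{3(L³−1)}` is polynomial against the Gaussian — effective only for `log β ≳ 6(1−s)L³` with the crude mass ratio.
HONEST FRAMING: finite-lattice gauge bookkeeping for a stub (S-BASE, (B-ST)) of a child of the CONDITIONAL reduction route R2b1; no kernel estimate refuted or proved;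
(B-ST) OPEN; C4 OPEN; not infinite volume, not a gap, not Clay.

## References
* M. Lüscher, Some analytic results concerning the mass spectrum of Yang–Mills gauge theories on a torus, Nucl. Phys. B219 (1983) 233–261, §2–3 (gauge fixing around the
  torons; Gribov-type copies on the torus). [Luscher1983]
-/

set_option autoImplicit false

noncomputable section

open Real MeasureTheory
open scoped BigOperators
open Literature.MathematicalPhysics.QuantumFieldTheory hiding SU2
open Literature.MathematicalPhysics.QuantumLattice

namespace Summit.QuantumFields.YangMills.Theorems.TwistedTraceScaling.Negative.R64

open Summit.QuantumFields.YangMills.Theorems.FemtoTransferGap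
open Summit.QuantumFields.YangMills.Theorems.FemtoTransferGap.TwoLattice.Toron (diagSU2_zero)
open Summit.QuantumFields.YangMills.Theorems.FemtoTransferGap.TwoLattice.ConstTube
open Summit.QuantumFields.YangMills.Theorems.TwistedTraceScaling.Negative.R29

variable {L : ℕ} [NeZero L]

/-! ## §1 The winding function is a BASED gauge transformation -/

omit [NeZero L] in
/-- The based extension of the restricted winding function is the winding function itself (it takes the value `1` at the origin). [folklore] -/
theorem basedExt_winding :
    basedExt L (fun z : NzSite L => diagSU2 (2 * π / L * ((z.1 0).val : ℝ))) = fun y : Site 3 L => diagSU2 (2 * π / L * ((y 0).val : ℝ)) := by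
  funext y
  by_cases hy : y = 0
  · subst hy
    rw [basedExt_zero]
    simp [diagSU2_zero]
  · rw [basedExt_of_ne L _ hy]

/-- ★ The BASED orbit of the vacuum contains the winding copy `constLift (diagSU2(−2π/L), 1, 1)`. [cite: Luscher1983, §2] -/
theorem vacuum_basedCopy (hL : 2 ≤ L) :
    gaugeTransform (basedExt L (fun z : NzSite L => diagSU2 (2 * π / L * ((z.1 0).val : ℝ)))) (fun _ : Edge 3 L => (1 : SU2)) =
      constLift L (fun e : Edge 3 1 => if e.2 = 0 then diagSU2 (-(2 * π / L)) else 1) := by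
  rw [basedExt_winding, winding_eq_constLift hL]

/-- ★ The based copy is on the linearised gauge SLICE: `gaugeCoordSq = 0`. [folklore] -/
theorem gaugeCoordSq_vacuum_basedCopy (hL : 2 ≤ L) :
    gaugeCoordSq L (gaugeTransform (basedExt L (fun z : NzSite L => diagSU2 (2 * π / L * ((z.1 0).val : ℝ)))) (fun _ : Edge 3 L => (1 : SU2))) = 0 := by
  rw [vacuum_basedCopy hL, gaugeCoordSq_constLift]

/-- ★ The based copy is OUTSIDE `nearOne ρ` for every `ρ ≤ 2√(1 − cos(2π/L))`. [cite: Luscher1983, §2] -/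
theorem vacuum_basedCopy_not_mem_nearOne (hL : 2 ≤ L) {ρ : ℝ} (hρ : ρ ≤ 2 * √(1 - Real.cos (2 * π / L))) :
    gaugeTransform (basedExt L (fun z : NzSite L => diagSU2 (2 * π / L * ((z.1 0).val : ℝ)))) (fun _ : Edge 3 L => (1 : SU2)) ∉ nearOne L ρ := by
  rw [vacuum_basedCopy hL]
  intro hmem
  apply conj_copy_not_mem_nearOne (L := L) hρ 1
  have h1 : gaugeTransform (fun _ : Site 3 L => (1 : SU2)) (constLift L (fun e : Edge 3 1 => if e.2 = 0 then diagSU2 (-(2 * π / L)) else 1)) =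
      constLift L (fun e : Edge 3 1 => if e.2 = 0 then diagSU2 (-(2 * π / L)) else 1) := by
    funext e; rw [gaugeTransform_const_apply, inv_one, one_mul, mul_one]
  rw [h1]; exact hmem

/-! ## §2 The vacuum is in the support of the record weight -/

/-- The vacuum is on the slice: `gaugeCoordSq 1̄ = 0`. [folklore] -/
theorem gaugeCoordSq_one : gaugeCoordSq L (fun _ : Edge 3 L => (1 : SU2)) = 0 := by
  have h1 : (fun _ : Edge 3 L => (1 : SU2)) = constLift L (fun _ : Edge 3 1 => (1 : SU2)) := by funext e; rw [constLift_apply]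
  rw [h1, gaugeCoordSq_constLift]

omit [NeZero L] in
/-- The vacuum is in `nearOne ρ` for every `ρ > 0`. [folklore] -/
theorem one_mem_nearOne {ρ : ℝ} (hρ : 0 < ρ) : (fun _ : Edge 3 L => (1 : SU2)) ∈ nearOne L ρ := by
  intro e
  simp only [OneMemClass.coe_one, sub_self, frobNorm_zero]
  exact hρ

/-- ★ The record weight at the vacuum is `1` (positive radii). [folklore] -/
theorem recordChi_one {s K M : ℝ} (hK : 0 < K) (hM : 0 < M) (β : ℝ) : recordChi L s K M β (fun _ : Edge 3 L => (1 : SU2)) = 1 := by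
  have hmem : (fun _ : Edge 3 L => (1 : SU2)) ∈ fatTubeRho L (fun β => K * powScale s β) (fun b => M * (K * powScale s b)) β := by
    refine ⟨one_mem_nearOne (mul_pos hM (mul_pos hK (powScale_pos s β))), ?_⟩
    show orbitDist _ < K * powScale s β
    rw [orbitDist_one]; exact mul_pos hK (powScale_pos s β)
  unfold recordChi recordWeightRho
  rw [Set.indicator_of_mem hmem, one_mul, gaugeCoordSq_one, zero_div, neg_zero, Real.exp_zero]

/-! ## §3 ★★ The based window set is not contained in the tube -/

/-- ★★ **THE BASED WINDOW SET OF THE VACUUM IS NOT CONTAINED IN `nearOne ρ`**: for every level `c ≥ 0` and every `ρ ≤ 2√(1 − cos(2π/L))`,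
`{h | gaugeCoordSq(1̄^{basedExt h}) ≤ c} ⊄ {h | 1̄^{basedExt h} ∈ nearOne ρ}` — the winding transform is in the first set (it is on the slice) and not in the second.
[cite: Luscher1983, §2] -/
theorem based_window_not_subset (hL : 2 ≤ L) {c ρ : ℝ} (hc : 0 ≤ c) (hρ : ρ ≤ 2 * √(1 - Real.cos (2 * π / L))) :
    ¬ ({h : NzSite L → SU2 | gaugeCoordSq L (gaugeTransform (basedExt L h) (fun _ : Edge 3 L => (1 : SU2))) ≤ c} ⊆
        {h : NzSite L → SU2 | gaugeTransform (basedExt L h) (fun _ : Edge 3 L => (1 : SU2)) ∈ nearOne L ρ}) := by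
  intro hsub
  have hmem : (fun z : NzSite L => diagSU2 (2 * π / L * ((z.1 0).val : ℝ))) ∈
      {h : NzSite L → SU2 | gaugeCoordSq L (gaugeTransform (basedExt L h) (fun _ : Edge 3 L => (1 : SU2))) ≤ c} := by
    show gaugeCoordSq L _ ≤ c
    rw [gaugeCoordSq_vacuum_basedCopy hL]; exact hc
  exact vacuum_basedCopy_not_mem_nearOne hL hρ (hsub hmem)

/-- ★★ **RECORD FORM, EVENTUALLY IN `β`**: for the record radii (`orbit radius Kβ^{-s}`, `link radius MKβ^{-s}`, `gauge width β^{-1}`, `s, K, M > 0`, `L ≥ 2`), eventually: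
the vacuum `1̄` is in `supp recordChi` (weight `1`), and its based orbit contains a point which is (i) in the Gaussian bulk `{gaugeCoordSq ≤ ½(β^{-1}·btLog β)²}` (indeed ON
the slice), (ii) NOT in `nearOne(MKβ^{-s})`, hence (iii) NOT in the fat tube / `supp recordChi` (weight `0`).  So the set inclusion «bulk of the based orbit ⊆ fat tube» of a
window lemma fails at a support point; only its MASS form can hold. [cite: Luscher1983, §2–3] -/
theorem based_window_containment_eventually_fails (hL : 2 ≤ L) {s K M : ℝ} (hs : 0 < s) (hK : 0 < K) (hM : 0 < M) :
    ∀ᶠ β : ℝ in Filter.atTop,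
      recordChi L s K M β (fun _ : Edge 3 L => (1 : SU2)) = 1 ∧
      ∃ h : NzSite L → SU2,
        gaugeCoordSq L (gaugeTransform (basedExt L h) (fun _ : Edge 3 L => (1 : SU2))) ≤ 1 / 2 * (powScale 1 β * btLog β) ^ 2 ∧
        gaugeTransform (basedExt L h) (fun _ : Edge 3 L => (1 : SU2)) ∉ nearOne L (M * (K * powScale s β)) ∧
        recordChi L s K M β (gaugeTransform (basedExt L h) (fun _ : Edge 3 L => (1 : SU2))) = 0 := by
  have hgap : 0 < 2 * √(1 - Real.cos (2 * π / L)) := mul_pos two_pos (Real.sqrt_pos.2 (one_sub_cos_pos hL))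
  obtain ⟨β0, hβ0⟩ := powScale_eventually_le hs (div_pos hgap (mul_pos hM hK))
  filter_upwards [Filter.eventually_ge_atTop β0] with β hβ
  have hρ : M * (K * powScale s β) ≤ 2 * √(1 - Real.cos (2 * π / L)) := by
    have h := hβ0 β hβ
    rw [le_div_iff₀ (mul_pos hM hK)] at h
    linarith
  refine ⟨recordChi_one hK hM β, fun z : NzSite L => diagSU2 (2 * π / L * ((z.1 0).val : ℝ)), ?_, vacuum_basedCopy_not_mem_nearOne hL hρ, ?_⟩
  · rw [gaugeCoordSq_vacuum_basedCopy hL]; positivity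
  · unfold recordChi recordWeightRho
    rw [Set.indicator_of_notMem, zero_mul]
    intro hmem
    exact vacuum_basedCopy_not_mem_nearOne hL hρ hmem.1


/-! ## §4 The islands have POSITIVE based-Haar mass (no almost-everywhere rescue) -/

/-- `gaugeCoordSq U ≤ ‖relLinkVec U‖² = Σ_e (1 − (U_e p_{dir e}⁻¹)₀²)`. [folklore] -/
theorem gaugeCoordSq_le_sum (U : GaugeConfig 3 L SU2) :
    gaugeCoordSq L U ≤ ∑ e : Edge 3 L, (1 - scalarPart (U e * (polarMean L e.2 U)⁻¹) ^ 2) := by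
  have h1 := (gaugeModes L).norm_starProjection_apply_le (relLinkVec L U)
  have h2 : ‖relLinkVec L U‖ ^ 2 = ∑ e : Edge 3 L, (1 - scalarPart (U e * (polarMean L e.2 U)⁻¹) ^ 2) := by
    rw [EuclideanSpace.norm_sq_eq, Fintype.sum_prod_type]
    simp only [relLinkVec, Real.norm_eq_abs, sq_abs]
    exact Finset.sum_congr rfl fun e _ => sum_vecPart_sq _
  have h0 := norm_nonneg ((gaugeModes L).starProjection (relLinkVec L U))
  unfold gaugeCoordSq
  rw [← h2]
  exact pow_le_pow_left₀ h0 h1 2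

omit [NeZero L] in
/-- `1 − s² ≤ 2(1 − s)` for `|s| ≤ 1`. [folklore] -/
theorem one_sub_sq_le {s : ℝ} (hs : |s| ≤ 1) : 1 - s ^ 2 ≤ 2 * (1 - s) := by
  rw [abs_le] at hs; nlinarith

/-- ★ Where all three direction sums are nonzero: `gaugeCoordSq U ≤ 2·Σ_k (|sites| − ‖M_k(U)‖)` — a CONTINUOUS majorant vanishing at every constant configuration
(`Σ_x (U_{(x,k)} p_k⁻¹)₀ = ‖M_k‖`, `…PolarMean.sum_scalarPart_mul_polarMean_inv`). [folklore] -/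
theorem gaugeCoordSq_le_defect {U : GaugeConfig 3 L SU2} (h : ∀ k : Fin 3, dirQuat L k U ≠ 0) :
    gaugeCoordSq L U ≤ 2 * ∑ k : Fin 3, ((Fintype.card (Site 3 L) : ℝ) - ‖dirQuat L k U‖) := by
  refine (gaugeCoordSq_le_sum U).trans ?_
  have hsum : ∑ e : Edge 3 L, 2 * (1 - scalarPart (U e * (polarMean L e.2 U)⁻¹)) =
      2 * ∑ k : Fin 3, ((Fintype.card (Site 3 L) : ℝ) - ‖dirQuat L k U‖) := by
    rw [Finset.mul_sum, Fintype.sum_prod_type_right]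
    refine Finset.sum_congr rfl fun k _ => ?_
    rw [← Finset.mul_sum, Finset.sum_sub_distrib, Finset.sum_const, Finset.card_univ, nsmul_eq_mul, mul_one,
      sum_scalarPart_mul_polarMean_inv L (h k)]
  rw [← hsum]
  exact Finset.sum_le_sum fun e _ => one_sub_sq_le (abs_scalarPart_le _)

/-- `U ↦ ‖M_k(U)‖` is continuous. [folklore] -/
theorem continuous_norm_dirQuat (k : Fin 3) : Continuous fun U : GaugeConfig 3 L SU2 => ‖dirQuat L k U‖ := by
  have hS : Continuous fun U : GaugeConfig 3 L SU2 => dirScalarSum L k U := by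
    unfold dirScalarSum; exact continuous_finsetSum _ fun x _ => continuous_scalarPart.comp (continuous_apply _)
  have hV : ∀ a : Fin 3, Continuous fun U : GaugeConfig 3 L SU2 => dirVecSum L k U a := fun a => by
    unfold dirVecSum
    simp only [Finset.sum_apply]
    exact continuous_finsetSum _ fun x _ => (continuous_apply a).comp (continuous_vecPart.comp (continuous_apply _))
  simp_rw [norm_dirQuat]
  exact ((hS.pow 2).add (continuous_finsetSum _ fun a _ => (hV a).pow 2)).sqrt

/-- At a constant configuration every direction sum has full norm `|sites|`. [folklore] -/
theorem norm_dirQuat_constLift (k : Fin 3) (u : GaugeConfig 3 1 SU2) : ‖dirQuat L k (constLift L u)‖ = Fintype.card (Site 3 L) := by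
  rw [norm_dirQuat]
  have hS : dirScalarSum L k (constLift L u) = Fintype.card (Site 3 L) * scalarPart (u (0, k)) := by
    unfold dirScalarSum; simp only [constLift_apply, Finset.sum_const, Finset.card_univ, nsmul_eq_mul]
  have hV : ∀ a : Fin 3, dirVecSum L k (constLift L u) a = Fintype.card (Site 3 L) * vecPart (u (0, k)) a := fun a => by
    unfold dirVecSum; simp only [constLift_apply, Finset.sum_const, Finset.card_univ, Finset.sum_apply, nsmul_eq_mul]
  simp_rw [hS, hV]
  have hunit : scalarPart (u (0, k)) ^ 2 + ∑ a, vecPart (u (0, k)) a ^ 2 = 1 := by rw [sum_vecPart_sq]; ring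
  have hcard : (0 : ℝ) ≤ Fintype.card (Site 3 L) := Nat.cast_nonneg _
  calc √((Fintype.card (Site 3 L) * scalarPart (u (0, k))) ^ 2 + ∑ a, (Fintype.card (Site 3 L) * vecPart (u (0, k)) a) ^ 2)
      = √((Fintype.card (Site 3 L) : ℝ) ^ 2 * (scalarPart (u (0, k)) ^ 2 + ∑ a, vecPart (u (0, k)) a ^ 2)) := by
        congr 1; rw [mul_add, Finset.mul_sum]; congr 1; · ring
        exact Finset.sum_congr rfl fun a _ => by ring
    _ = Fintype.card (Site 3 L) := by rw [hunit, mul_one, Real.sqrt_sq hcard]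

omit [NeZero L] in
/-- `h ↦ 1̄^{basedExt h}` is continuous on the based gauge group. [folklore] -/
theorem continuous_based_vacuum : Continuous fun h : NzSite L → SU2 => gaugeTransform (basedExt L h) (fun _ : Edge 3 L => (1 : SU2)) := by
  have hb : Continuous (basedExt L) := by
    refine continuous_pi fun x => ?_
    by_cases hx : x = 0
    · simp only [basedExt, hx]; exact continuous_const
    · simp only [basedExt, hx]; exact continuous_apply _
  refine continuous_pi fun e => ?_
  simp only [gaugeTransform]
  exact (((continuous_apply e.1).comp hb).mul continuous_const).mul ((continuous_apply (e.1.shift e.2)).comp hb).inv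

/-- ★ The ISLAND NEIGHBOURHOOD of the winding transform — based `h` whose vacuum image has its `(0,0)`-link more than `ρ` away from `1` and all direction sums of norm
`> |sites| − c` — is OPEN in the based gauge group. [folklore] -/
theorem isOpen_island (ρ c : ℝ) :
    IsOpen {h : NzSite L → SU2 | ρ < frobNorm (((gaugeTransform (basedExt L h) (fun _ : Edge 3 L => (1 : SU2)) ((0 : Site 3 L), (0 : Fin 3)) : SU2) :
        Matrix (Fin 2) (Fin 2) ℂ) - 1) ∧
      ∀ k : Fin 3, (Fintype.card (Site 3 L) : ℝ) - c < ‖dirQuat L k (gaugeTransform (basedExt L h) (fun _ : Edge 3 L => (1 : SU2)))‖} := by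
  have hO : IsOpen {U : GaugeConfig 3 L SU2 | ρ < frobNorm (((U ((0 : Site 3 L), (0 : Fin 3)) : SU2) : Matrix (Fin 2) (Fin 2) ℂ) - 1) ∧
      ∀ k : Fin 3, (Fintype.card (Site 3 L) : ℝ) - c < ‖dirQuat L k U‖} := by
    rw [Set.setOf_and, Set.setOf_forall]
    exact (isOpen_lt continuous_const (continuous_frobNorm_link_sub_one L _)).inter
      (isOpen_iInter_of_finite fun k => isOpen_lt continuous_const (continuous_norm_dirQuat k))
  exact hO.preimage continuous_based_vacuum

/-- ★ The winding transform lies in the island neighbourhood (`ρ < 2√(1 − cos(2π/L))`, `c > 0`). [cite: Luscher1983, §2] -/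
theorem winding_mem_island (hL : 2 ≤ L) {ρ c : ℝ} (hρ : ρ < 2 * √(1 - Real.cos (2 * π / L))) (hc : 0 < c) :
    (fun z : NzSite L => diagSU2 (2 * π / L * ((z.1 0).val : ℝ))) ∈
      {h : NzSite L → SU2 | ρ < frobNorm (((gaugeTransform (basedExt L h) (fun _ : Edge 3 L => (1 : SU2)) ((0 : Site 3 L), (0 : Fin 3)) : SU2) :
          Matrix (Fin 2) (Fin 2) ℂ) - 1) ∧
        ∀ k : Fin 3, (Fintype.card (Site 3 L) : ℝ) - c < ‖dirQuat L k (gaugeTransform (basedExt L h) (fun _ : Edge 3 L => (1 : SU2)))‖} := by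
  refine ⟨?_, fun k => ?_⟩
  · rw [vacuum_basedCopy hL, constLift_apply]
    dsimp only
    rw [if_pos rfl, frobNorm_copyLink]
    exact hρ
  · rw [vacuum_basedCopy hL, norm_dirQuat_constLift]
    linarith

/-- ★ The island neighbourhood has POSITIVE based-Haar mass (product Haar charges open sets). [folklore] -/
theorem basedMeasure_island_pos (hL : 2 ≤ L) {ρ c : ℝ} (hρ : ρ < 2 * √(1 - Real.cos (2 * π / L))) (hc : 0 < c) :
    0 < basedMeasure L {h : NzSite L → SU2 | ρ < frobNorm (((gaugeTransform (basedExt L h) (fun _ : Edge 3 L => (1 : SU2)) ((0 : Site 3 L), (0 : Fin 3)) : SU2) :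
        Matrix (Fin 2) (Fin 2) ℂ) - 1) ∧
      ∀ k : Fin 3, (Fintype.card (Site 3 L) : ℝ) - c < ‖dirQuat L k (gaugeTransform (basedExt L h) (fun _ : Edge 3 L => (1 : SU2)))‖} := by
  haveI : (haarProbability SU2).IsOpenPosMeasure := by unfold haarProbability; infer_instance
  exact (isOpen_island ρ c).measure_pos (basedMeasure L) ⟨_, winding_mem_island hL hρ hc⟩

/-- ★★ **THE WINDOW SET FAILS THE TUBE ON A SET OF POSITIVE BASED-HAAR MASS**: for every level `c > 0` and every `ρ < 2√(1 − cos(2π/L))`,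
`basedMeasure {h | gaugeCoordSq(1̄^{basedExt h}) ≤ c ∧ 1̄^{basedExt h} ∉ nearOne ρ} > 0` — the inclusion «Gaussian bulk of the based orbit ⊆ nearOne» fails not only at
the winding point but on a neighbourhood of it; no almost-everywhere form of the containment holds either. [cite: Luscher1983, §2–3] -/
theorem basedMeasure_window_diff_nearOne_pos (hL : 2 ≤ L) {c ρ : ℝ} (hc : 0 < c) (hρ : ρ < 2 * √(1 - Real.cos (2 * π / L))) :
    0 < basedMeasure L {h : NzSite L → SU2 | gaugeCoordSq L (gaugeTransform (basedExt L h) (fun _ : Edge 3 L => (1 : SU2))) ≤ c ∧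
      gaugeTransform (basedExt L h) (fun _ : Edge 3 L => (1 : SU2)) ∉ nearOne L ρ} := by
  have hL1 : (1 : ℝ) ≤ Fintype.card (Site 3 L) := by exact_mod_cast Fintype.card_pos
  set c' : ℝ := min (c / 6) 1 with hc'
  have hc'0 : 0 < c' := lt_min (by linarith) one_pos
  have hc'c : 6 * c' ≤ c := by have := min_le_left (c / 6) 1; linarith
  have hc'1 : c' ≤ 1 := min_le_right _ _
  refine lt_of_lt_of_le (basedMeasure_island_pos hL hρ hc'0) (MeasureTheory.measure_mono ?_)
  rintro h ⟨hlink, hdir⟩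
  have hne : ∀ k : Fin 3, dirQuat L k (gaugeTransform (basedExt L h) (fun _ : Edge 3 L => (1 : SU2))) ≠ 0 := fun k => by
    rw [← norm_pos_iff]; linarith [hdir k]
  refine ⟨(gaugeCoordSq_le_defect (hne)).trans ?_, fun hmem => ?_⟩
  · have : ∑ k : Fin 3, ((Fintype.card (Site 3 L) : ℝ) - ‖dirQuat L k (gaugeTransform (basedExt L h) (fun _ : Edge 3 L => (1 : SU2)))‖) ≤ 3 * c' := by
      calc ∑ k : Fin 3, ((Fintype.card (Site 3 L) : ℝ) - ‖dirQuat L k (gaugeTransform (basedExt L h) (fun _ : Edge 3 L => (1 : SU2)))‖)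
          ≤ ∑ _k : Fin 3, c' := Finset.sum_le_sum fun k _ => by linarith [hdir k]
        _ = 3 * c' := by rw [Finset.sum_const, Finset.card_univ, Fintype.card_fin, nsmul_eq_mul, Nat.cast_ofNat]
    linarith
  · exact absurd (hmem ((0 : Site 3 L), (0 : Fin 3))) (not_lt.2 hlink.le)

/-- ★★ **RECORD FORM**: eventually in `β`, a set of based transformations of POSITIVE Haar mass carries the vacuum (weight `1`) into the Gaussian bulk
`{gaugeCoordSq ≤ ½(β^{-1}·btLog β)²}` and OUT of `supp recordChi` (weight `0`).  The (S6′)/(W1-2) window statement must therefore be the MASS form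
«`basedMeasure {h : U^h ∈ fat tube ∧ gaugeCoordSq(U^h) ≤ ½w²} ≥ m₀(β,L) > 0` whenever `orbitDist U < Kβ^{-s}`», which the islands do not affect (the weight vanishes there).
[cite: Luscher1983, §2–3] -/
theorem basedMeasure_bulk_off_support_eventually_pos (hL : 2 ≤ L) {s K M : ℝ} (hs : 0 < s) (hK : 0 < K) (hM : 0 < M) :
    ∀ᶠ β : ℝ in Filter.atTop,
      recordChi L s K M β (fun _ : Edge 3 L => (1 : SU2)) = 1 ∧
      0 < basedMeasure L {h : NzSite L → SU2 |
        gaugeCoordSq L (gaugeTransform (basedExt L h) (fun _ : Edge 3 L => (1 : SU2))) ≤ 1 / 2 * (powScale 1 β * btLog β) ^ 2 ∧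
        recordChi L s K M β (gaugeTransform (basedExt L h) (fun _ : Edge 3 L => (1 : SU2))) = 0} := by
  have hgap : 0 < 2 * √(1 - Real.cos (2 * π / L)) := mul_pos two_pos (Real.sqrt_pos.2 (one_sub_cos_pos hL))
  obtain ⟨β0, hβ0⟩ := powScale_eventually_le hs (div_pos (half_pos hgap) (mul_pos hM hK))
  filter_upwards [Filter.eventually_ge_atTop β0] with β hβ
  have hρ : M * (K * powScale s β) < 2 * √(1 - Real.cos (2 * π / L)) := by
    have h := hβ0 β hβ
    rw [le_div_iff₀ (mul_pos hM hK)] at h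
    linarith
  have hw : 0 < 1 / 2 * (powScale 1 β * btLog β) ^ 2 := by
    have := powScale_pos 1 β; have := one_le_btLog β; positivity
  refine ⟨recordChi_one hK hM β, lt_of_lt_of_le (basedMeasure_window_diff_nearOne_pos hL hw hρ) (MeasureTheory.measure_mono ?_)⟩
  rintro h ⟨hgcs, hnot⟩
  refine ⟨hgcs, ?_⟩
  unfold recordChi recordWeightRho
  rw [Set.indicator_of_notMem, zero_mul]
  exact fun hmem => hnot hmem.1

end Summit.QuantumFields.YangMills.Theorems.TwistedTraceScaling.Negative.R64

end
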